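import Summits.QuantumFields.YangMills.Theorems.BalabanUVNodesK2CornerRoadRowMassRuns
import Summits.QuantumFields.YangMills.Theorems.BalabanUVNodesK2CornerRoadLine2

/-!
# Route `BalabanUVNodes` rev 29 — THE ROW-MASS ROAD KEYED: K2⁷ ∕ K1⁸ ∕ K1⁹ BY NAME, the [I] Thm 2-AS-TYPED interface, the fading comparison, and the K1 «v9» LINE-2 editions
# (the registered V-stub signatures under {N11CU at the slot world, the ∀θ row-mass-runs letter}) — hypothesis form; 0 `def`, 0 `sorry`

Cell `ym-nodeO-ideate`, PROVER seat `ym-nodeO-port-1` (gen 5).  Sibling of `…K2CornerRoadRowMassRuns` (this seat: the PORT of ym-nodeO IDEA-7 g13's `Cruxes/EndpointGivenBR13SepCoPH/Idea7RunCurrency.lean`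
ED.2 93fe73230dca §B — generic `β`: row-mass transfer, extremal (0.31)-profile, constant-history drift, ★★ `betaAvgAFH_of_runs_rowMass`, ★★ `rowsTriple_of_runs_rowMass` ∕ `rowsBounded_of_runs_rowMass`,
minimal keyed §4) and of `…K2CornerRoadLine2` (p630391: the LINE-2 doors — `runRowsContAtSomeRecord13PWSV`-level producers over DEF-1's `K1V9Defs`, the N11CU raise at the slot world
`ceilingKeyedRung1V_of_nodes_of_b14Raise`).  Helper keyed `--supports stmt-QuantumFields-27364 --as helper` (K1⁹, DECIDING); count-neutral; NO skeleton registered or re-keyed.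
ATTRIBUTION as in the sibling: the displayed-run road is b2b-balaban-beta-bflow-p2's (#70a ∕ #70b ∕ part 10; `runs_of_theorem2`, `sqrt_absorb`, `rowSum_le` BY NAME), the row-mass currency is
CRIT-2's R-BM ∕ p622247, the fading-free re-cut is IDEA-7 g13's (CRIT-2 ROUND 8 CONFIRMED).

CONTENTS.  §1 THE FADING LETTER IS A ROW-MASS BOUND: `rowMass_of_fadingMemory` (`FadingMemory C θ Λ`, `0 ≤ θ < 1` ⟹ row mass `C∕(1−θ)`, bflow-p2's `rowSum_le`) · `betaAvgAFH_of_runs_fadingMemory_sharper`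
(bflow-p2 part 10's hypotheses ⟹ `BetaAvgAFH (s∕4) (4C²∕((1−θ)²s²)) δ β`, WITHOUT the `Cγθ∕(1−θ)²` defect) · `…_literal` (part 10's statement back).  §1b THE PRICE (CRIT-2 ROUND 8 (κ), CRIT-2 g4's
pre-filing request): `topStep_lower_of_discrete031` (a displayed (0.31)-run of depth `K ≥ 1` forces `s ≤ β_{K−1}(run)` — the (α♭) letter CARRIES a pointwise AF-sign datum at every depth) ·
`pointwiseSign_of_rowMassRunsText`.  §2 THE AS-PRINTED INTERFACE:
`runRowsCont13_of_typedTheorem2_rowMass` ([Balaban1987RG1] Thm 2 AS TYPED at one `Setting` — a HYPOTHESIS, unproved in print — + prover 1's binder `hrg` + U3ᴷ-lite moduli with row mass ⟹ DEF-1's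
`RunRowsCont13 F θ`; bflow-p2's `runs_of_theorem2` BY NAME).  §3 BY NAME from the ∀θ row-mass-runs letter (idea-7's `RowMassRunsAll`, INLINE): the carrier's aside decl K2⁷
`…Theses.BalabanUVNodes.EndpointGivenBR13SepCoPH` (stmt-QuantumFields-20543; DEF-1's `endpointGivenBR13SepCoPH_of_rowsContAll`) and the aside K1⁸ (26907) from K1⁷.  §4 K1 «v9» LINE 2
(V-rungs BY NAME over `K1V9Defs`; ANCHOR-FREE, DRIFT-FREE): `runLettersAtCeiling_of_rowMass_runs` (generic: the stub-2ⱽ∘3ⱽ run-letter bundle «∃ b r γ₀ B M, … ∧ b ≤ B ∧ B + r ≤ c ∧ …» at ANY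
ceiling `c ≥ s′ + 2Lγ + 2L∕√s`) · `runLettersAtCeiling_at_of_rowMassRuns` (θ-level) · `runRowsContAtSomeRecord13PWSV_of_rung1VAt_rowMassRuns_le` · `…_of_ceilingKeyedRung1V_rowMassRuns` ·
★ `stub_runRowsCont13VText_of_n11CUV_rowMassRunsText` (the REGISTERED joint stub text 2ⱽ∘3ⱽ «∀ F, NodesAtSomeRecord13PWSV F → RunRowsContAtSomeRecord13PWSV F» from {N11 ceiling-uniform at rung-1ⱽ
core data, the ∀θ row-mass-runs letter}) · `stub_runRows13PWSVText_of_n11CUV_rowMassRunsText` (= the registered `stub_runRows13PWSV` signature literally) · ★★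
`stabilityBRunRowsAtRecordR13SepCoPHV_of_ceilingKeyedRung1VWithRowMassRuns` (∃-side producer, letters AT THE WITNESS) · ★★ `stabilityBRunRowsAtRecordR13SepCoPHV_of_stub1VText_n11CUV_rowMassRunsText`
(K1⁹ BY NAME from the REGISTERED stub 1ⱽ text + N11CU + the letter: stub 2ⱽ ⟸ {N11CU, U3ᴷ-lite moduli-with-row-mass, (α♭) one lower-(0.31) run per depth}; stub 3ⱽ ⟸ {moduli} — the LINE-2
ledger of the row-mass road) · ★ `stub_cont13VText_of_boxModuli` (the registered `stub_cont13V` signature from moduli on SOME box — generalises p630391's `…_of_histModuliU`).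

HONEST FRAMING.  Elementary real analysis on DISPLAYED hypothesis shapes + doors BY NAME; NOTHING of Bałaban's analysis is asserted or discharged; the (α♭) input is [Balaban1987RG1] Thm 2's
two-sided (0.31) p. 259 read as a HYPOTHESIS (UNPROVED IN PRINT); whether U3ᴷ-lite (moduli + row mass), (α♭) and N11CU are inhabited at the record is the U3 ∕ B12 sub-cell ∕ N11 desks'
question, NOT claimed (instance 0∕1); no stub proved or closed; K0⁷ ∕ K1⁹ (v9 0∕6) ∕ K3⁸ OPEN; counts unmoved (typed 28∕28 · discharged 5∕27 (A 5∕28)); [I] §1's continuity pp. 263–264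
unproved in print; [Balaban1988Convergent] Cor. 3 (2.50) proved in no currency; route R4 closes the CONDITIONAL finite-𝕋⁴ rung `BalabanLadder.UV` only — NOT the continuum limit, NOT ℝ⁴, NOT
OS, NOT the Yang–Mills mass gap, NOT Clay.  No `def`, no `instance`, no `notation`, no `axiom`.
Sources (context only): [I] = [Balaban1987RG1] CMP **109** (1987): (0.20) p. 256, Thm 2 + (0.31) p. 259, §1 pp. 263–264, (1.22) p. 264, Thm 3 p. 264, (2.12)–(2.14) p. 268, (5.10) p. 293,
§5 p. 298; [III] = [Balaban1988Convergent] CMP **119** (1988): Thm 1 p. 262, (2.6) p. 255; [V] = [Balaban1989LargeFieldII] CMP **122** (1989): Thm 1 p. 355, (0.1) pp. 355–356.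
-/

noncomputable section

open scoped Matrix.Norms.L2Operator

namespace Summit.QuantumFields.YangMills.Theorems.BalabanUVNodesK2CornerRoadRowMassRunsKeyed

open Finset
open Literature.MathematicalPhysics.QuantumFieldTheory.Balaban1983to89
open Literature.MathematicalPhysics.QuantumFieldTheory.Balaban1983to89.T4Continuum
open Literature.MathematicalPhysics.QuantumFieldTheory.Balaban1983to89.DagBinding
open Literature.MathematicalPhysics.QuantumFieldTheory.Balaban1983to89.FlowStep (HBeta prefixOf prefixOf_apply Box mem_box RGEqH clampPrefix Y)
open Literature.MathematicalPhysics.QuantumFieldTheory.Balaban1983to89.FlowStepRuns (BetaPartialSumsLowerH)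
open Literature.MathematicalPhysics.QuantumFieldTheory.Balaban1983to89.T4CouplingMatching (HistLipschitz FadingMemory)
open Literature.MathematicalPhysics.QuantumFieldTheory.Balaban1983to89.Beta.AveragedAFCarrier (BetaAvgAFH)
open Literature.MathematicalPhysics.QuantumFieldTheory.Balaban1983to89.B12BetaAsPrinted (Setting Theorem2Statement)
open Summit.QuantumFields.BalabanUV.Beta.EriceFlowEnclosureB12AsPrintedPointwiseFading (rowSum_le)
open Summit.QuantumFields.BalabanUV.Beta.EriceFlowEnclosureB12AsPrintedPointwiseFadingDrift (runs_of_theorem2)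
open Summit.QuantumFields.YangMills.Theorems.BalabanUVNodesK2NamedJetsRunRemAt (RunConstRemainder SurvCont)
open Summit.QuantumFields.YangMills.Theorems.BalabanUVNodesK1R8RowsDefs
  (RunRowsCont13 RowsContAll runRowsCont13_iff_inline endpointGivenBR13SepCoPH_of_rowsContAll stabilityBRunRowsAtRecordR13SepCoPH_of_k17_rowsContAll)
open Summit.QuantumFields.YangMills.Theorems.K1V6Defs (Inhabited13)
open Summit.QuantumFields.YangMills.Theorems.K1V9Defs
  (RecordSV NodesAtSomeRecord13PWSV RunRowsAtSomeRecord13PWSV RunRowsContAtSomeRecord13PWSV runRowsAtSomeRecord13PWSV_of_runRowsContAtSomeRecord13PWSV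
    stabilityBRunRowsAtRecordR13SepCoPHV_of_rung0_runRowsContV stabilityBRunRowsAtRecordR13SepCoPHV_of_stubTextsV)
open Summit.QuantumFields.YangMills.Theses.BalabanUVNodes (EndpointGivenBR13SepCoPH StabilityBAtRecordR13SepCoPH StabilityBRunRowsAtRecordR13SepCoPH StabilityBRunRowsAtRecordR13SepCoPHV)
open Summit.QuantumFields.YangMills.Theorems.BalabanUVNodesK2CornerRoadRowMassRuns
  (rowMass_nonneg betaAvgAFH_of_runs_rowMass rowsTriple_of_runs_rowMass rowsBounded_of_runs_rowMass runRowsCont13_of_rowMass_runs rowsContAll_of_rowMassRunsText)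
open Summit.QuantumFields.YangMills.Theorems.BalabanUVNodesK2CornerRoadLine2 (ceilingKeyedRung1V_of_nodes_of_b14Raise)

/-! ## §1 The fading letter is a row-mass bound; bflow-p2 part 10 re-derived with a smaller defect -/

section Fading

variable {β : HBeta} {γ L δ s s' : ℝ} {Λ : ℕ → ℕ → ℝ}

/-- `FadingMemory C θ Λ` (`0 ≤ θ < 1`, `0 ≤ C`) IS a row-mass bound with `L = C∕(1−θ)` (bflow-p2 part 9's `rowSum_le` BY NAME; entries nonnegative by the letter) — so every row-mass
theorem of the sibling SUBSUMES its fading twin (idea-7 g13 `rowMass_of_fadingMemory`). [folklore] -/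
theorem rowMass_of_fadingMemory {C θ : ℝ} (hθ0 : 0 ≤ θ) (hθ1 : θ < 1) (hC : 0 ≤ C) (hΛ : FadingMemory C θ Λ) (k : ℕ) :
    ∑ i : Fin (k + 1), |Λ k i| ≤ C / (1 - θ) := by
  have h : ∑ i : Fin (k + 1), |Λ k i| = ∑ i : Fin (k + 1), Λ k i :=
    Finset.sum_congr rfl fun i _ => abs_of_nonneg (hΛ k i (Nat.le_of_lt_succ i.isLt)).1
  rw [h]; exact rowSum_le hθ0 hθ1 hC hΛ k

/-- **bflow-p2 part 10 RE-DERIVED WITH A SMALLER DEFECT** (idea-7 g13): the same hypotheses as `…PointwiseFadingDrift.betaAvgAFH_of_runs_fadingMemory` give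
`BetaAvgAFH (s∕4) (4C²∕((1−θ)²s²)) δ β` — WITHOUT the `Cγθ∕(1−θ)²` term. [cite: Balaban1987RG1, Thm 2 (0.31) p.259 with (0.20) p.256 and §5 p.298] -/
theorem betaAvgAFH_of_runs_fadingMemory_sharper {C θ : ℝ} (hL : HistLipschitz Λ γ β) (hΛ : FadingMemory C θ Λ) (hθ0 : 0 ≤ θ) (hθ1 : θ < 1) (hC : 0 ≤ C)
    (hδ : 0 < δ) (hδγ : δ ≤ γ) (hs : 0 < s) (hsmall : 4 * C * δ ≤ s * (1 - θ))
    (hruns : ∀ K : ℕ, ∃ r : ℕ → ℝ, RGEqH K β r ∧ Step.InInterval γ K r ∧ Step.Discrete031 s s' K (r K) r) :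
    BetaAvgAFH (s / 4) (4 * C ^ 2 / ((1 - θ) ^ 2 * s ^ 2)) δ β := by
  have h1θ : 0 < 1 - θ := by linarith
  have hM := rowMass_of_fadingMemory hθ0 hθ1 hC hΛ
  have hsmall' : 4 * (C / (1 - θ)) * δ ≤ s := by
    rw [show 4 * (C / (1 - θ)) * δ = 4 * C * δ / (1 - θ) by ring, div_le_iff₀ h1θ]; exact hsmall
  have h := betaAvgAFH_of_runs_rowMass hL hM hδ hδγ hs hsmall' hruns
  have e : 4 * (C / (1 - θ)) ^ 2 / s ^ 2 = 4 * C ^ 2 / ((1 - θ) ^ 2 * s ^ 2) := by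
    rw [div_pow]; field_simp
  rw [e] at h; exact h

/-- … and part 10's LITERAL statement back (weakening the defect; idea-7 g13 `…_literal`). [cite: Balaban1987RG1, Thm 2 (0.31) p.259 with (0.20) p.256 and §5 p.298] -/
theorem betaAvgAFH_of_runs_fadingMemory_literal {C θ : ℝ} (hL : HistLipschitz Λ γ β) (hΛ : FadingMemory C θ Λ) (hθ0 : 0 ≤ θ) (hθ1 : θ < 1) (hC : 0 ≤ C)
    (hδ : 0 < δ) (hδγ : δ ≤ γ) (hs : 0 < s) (hsmall : 4 * C * δ ≤ s * (1 - θ))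
    (hruns : ∀ K : ℕ, ∃ r : ℕ → ℝ, RGEqH K β r ∧ Step.InInterval γ K r ∧ Step.Discrete031 s s' K (r K) r) :
    BetaAvgAFH (s / 4) (4 * C ^ 2 / ((1 - θ) ^ 2 * s ^ 2) + C * γ * θ / (1 - θ) ^ 2) δ β := by
  have hγ : 0 ≤ γ := hδ.le.trans hδγ
  exact (betaAvgAFH_of_runs_fadingMemory_sharper hL hΛ hθ0 hθ1 hC hδ hδγ hs hsmall hruns).of_le le_rfl (le_add_of_nonneg_right (by positivity))

end Fading

/-! ## §1b THE PRICE OF THE (α♭) INPUT (CRIT-2 ROUND 8 finding (κ); CRIT-2 g4's pre-filing request HOME STATUS 2026-08-28T11:51:48Z): the hidden pointwise sign datum -/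

section Price

variable {β : HBeta} {s s' : ℝ}

/-- **THE HIDDEN POINTWISE SIGN DATUM OF THE DISPLAYED (0.31)-RUN FAMILY** (idea-7 g13 `topStep_lower_of_discrete031`, ported verbatim): a run of (0.20) of depth `K ≥ 1` with
`Step.Discrete031 s s′ K (r_K) r` has `s ≤ β_{K−1}(r_0,…,r_{K−1})` (last step of the telescope against (0.31) at `k = K−1`).  So the hypothesis `hruns` of the sibling's
`rowsTriple_of_runs_rowMass` ∕ `betaAvgAFH_of_runs_rowMass` and of every theorem of §2–§4 below carries, for every `K`, ONE history of length `K` inside the box on which `β ≥ s > 0` — a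
POINTWISE asymptotic-freedom datum at arbitrarily deep scales, which is exactly what the rows' floor (iv) is made of; the road therefore sits at the SAME (D1)∕AF-sign wall as the corner road's
`0 < s` in `OneLoopDrift` (K1⁹'s `why_might_fail` «(iv) needs the (D1)∕AF drift sign»), in another currency — it does not evade it.  [cite: Balaban1987RG1, (0.31) p.259 with (0.20) p.256] -/
theorem topStep_lower_of_discrete031 {K : ℕ} {r : ℕ → ℝ} (hK : 1 ≤ K) (hrg : RGEqH K β r) (hD : Step.Discrete031 s s' K (r K) r) :
    s ≤ β (K - 1) (prefixOf r (K - 1)) := by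
  have hk : K - 1 ≤ K := Nat.sub_le K 1
  have htel := FlowStep.inv_sq_telescopeH hrg hk le_rfl
  have h31 := (hD (K - 1) hk).1
  have hIco : Ico (K - 1) K = {K - 1} := by
    rw [← Nat.Ico_succ_singleton]; congr 1; omega
  have hcast : ((K : ℝ) - ((K - 1 : ℕ) : ℝ)) = 1 := by
    rw [Nat.cast_sub hK]; push_cast; ring
  rw [hcast, mul_one] at h31
  rw [hIco, Finset.sum_singleton] at htel
  linarith

/-- … hence the ∀θ row-mass-runs letter hands, at every admissible tuple with provisos and EVERY depth `K ≥ 1`, an in-box history of length `K` on which `β_θ ≥ s > 0` (the letter's own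
slope).  Displayed so that a Theorems-lane reader sees the whole price of the road (CRIT-2 g4).  CONDITIONAL on the letter; nothing of Bałaban's β asserted.
[cite: Balaban1987RG1, Thm 2 (0.31) p.259 with (0.20) p.256] -/
theorem pointwiseSign_of_rowMassRunsText
    (hRM : ∀ (F : T4Family) (θ : Node00.Stage13HParams F 2), θ.Provisos₁₃SepCoPH F 2 → θ.Admissible F 2 →
      ∃ (γ L s s' : ℝ) (Λ : ℕ → ℕ → ℝ), HistLipschitz Λ γ (Node00.betaOfRecord₁₃ F 2 θ.toStage13Params) ∧ (∀ k, ∑ i : Fin (k + 1), |Λ k i| ≤ L) ∧ 0 < γ ∧ 0 < s ∧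
        ∀ K : ℕ, ∃ r : ℕ → ℝ, RGEqH K (Node00.betaOfRecord₁₃ F 2 θ.toStage13Params) r ∧ Step.InInterval γ K r ∧ Step.Discrete031 s s' K (r K) r)
    (F : T4Family) (θ : Node00.Stage13HParams F 2) (hP : θ.Provisos₁₃SepCoPH F 2) (hθ : θ.Admissible F 2) :
    ∃ γ s : ℝ, 0 < γ ∧ 0 < s ∧ ∀ K : ℕ, 1 ≤ K → ∃ r : ℕ → ℝ, Step.InInterval γ K r ∧ s ≤ Node00.betaOfRecord₁₃ F 2 θ.toStage13Params (K - 1) (prefixOf r (K - 1)) := by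
  obtain ⟨γ, -, s, s', -, -, -, hγ, hs, hruns⟩ := hRM F θ hP hθ
  refine ⟨γ, s, hγ, hs, fun K hK => ?_⟩
  obtain ⟨r, hrg, hI, hD⟩ := hruns K
  exact ⟨r, hI, topStep_lower_of_discrete031 hK hrg hD⟩

end Price

/-! ## §2 [I] Thm 2 AS TYPED at one `Setting` + `hrg` + U3ᴷ-lite with row mass ⟹ DEF-1's rows -/

section AsPrinted

variable {F : T4Family}

/-- **THE AS-PRINTED INTERFACE AT THE TUPLE + U3ᴷ-lite ⟹ THE ROWS, FADING-FREE** (idea-7 g13 `runRowsCont13_of_typedTheorem2_rowMass`; bflow-p2 #70b §2's `runRowsCont13_of_typedTheorem2` with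
node U2's `FadingMemory` replaced by a row-mass bound): `Theorem2Statement S hL` AS TYPED (a HYPOTHESIS, unproved in print) + prover 1's binder `hrg` on `]0, γ_U]` + `HistLipschitz Λ γ_U S.β` with
`Σ_i |Λ_{k,i}| ≤ L` ⟹ `RunRowsCont13 F θ` (bflow-p2's `runs_of_theorem2` BY NAME ⟶ the sibling's `rowsTriple_of_runs_rowMass`).  READING: K1⁹'s rows conjunct ≤ «[I] Thm 2 AS TYPED at one
endpoint + `hrg` + U3ᴷ-lite».  CONDITIONAL; nothing of Bałaban's β asserted. [cite: Balaban1987RG1, Thm 2 (0.31) p.259, Thm 3 p.264, §1 pp.263-264, (5.10) p.293, §5 p.298] -/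
theorem runRowsCont13_of_typedTheorem2_rowMass (θ : Node00.Stage13HParams F 2) (S : Setting)
    (hSβ : S.β = Node00.betaOfRecord₁₃ F 2 θ.toStage13Params) {hL : Odd S.L ∧ 1 < S.L} (hT : Theorem2Statement S hL)
    {γU L : ℝ} {Λ : ℕ → ℕ → ℝ} (hγU : 0 < γU)
    (hrg : ∀ P : B12.RunParams, Step.InInterval γU P.K (S.cpl P) → RGEqH P.K S.β (S.cpl P))
    (hLip : HistLipschitz Λ γU S.β) (hM : ∀ k, ∑ i : Fin (k + 1), |Λ k i| ≤ L) :
    RunRowsCont13 F θ := by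
  obtain ⟨s, s', hs, -, hruns⟩ := runs_of_theorem2 hT hγU hrg
  have h := rowsTriple_of_runs_rowMass hLip hM hγU hs hruns
  rw [hSβ] at h
  obtain ⟨b, r, γ₀, M, hγ₀, -, h'⟩ := h
  exact (runRowsCont13_iff_inline F θ).mpr ⟨b, r, γ₀, M, hγ₀, h'⟩

end AsPrinted

/-! ## §3 BY NAME from the ∀θ row-mass-runs letter: the carrier K2⁷ (aside) and K1⁸ (aside) -/

section Asides

/-- **THE CARRIER's ASIDE DECL K2⁷ `…Theses.BalabanUVNodes.EndpointGivenBR13SepCoPH` (stmt-QuantumFields-20543) BY NAME** from the ∀θ row-mass-runs letter (idea-7's `RowMassRunsAll`, INLINE;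
DEF-1's `endpointGivenBR13SepCoPH_of_rowsContAll` ∘ the sibling's `rowsContAll_of_rowMassRunsText`).  CONDITIONAL on the displayed letter; K2⁷ NOT closed.
[cite: Balaban1987RG1, Thm 2 p.259 (first sentence) and (0.31), Thm 3 p.264, (5.10) p.293] -/
theorem endpointGivenBR13SepCoPH_of_rowMassRunsText
    (h : ∀ (F : T4Family) (θ : Node00.Stage13HParams F 2), θ.Provisos₁₃SepCoPH F 2 → θ.Admissible F 2 →
      ∃ (γ L s s' : ℝ) (Λ : ℕ → ℕ → ℝ), HistLipschitz Λ γ (Node00.betaOfRecord₁₃ F 2 θ.toStage13Params) ∧ (∀ k, ∑ i : Fin (k + 1), |Λ k i| ≤ L) ∧ 0 < γ ∧ 0 < s ∧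
        ∀ K : ℕ, ∃ r : ℕ → ℝ, RGEqH K (Node00.betaOfRecord₁₃ F 2 θ.toStage13Params) r ∧ Step.InInterval γ K r ∧ Step.Discrete031 s s' K (r K) r) :
    EndpointGivenBR13SepCoPH :=
  endpointGivenBR13SepCoPH_of_rowsContAll (rowsContAll_of_rowMassRunsText h)

/-- **THE ASIDE K1⁸ `…Theses.BalabanUVNodes.StabilityBRunRowsAtRecordR13SepCoPH` (26907) FROM THE ASIDE K1⁷ + the ∀θ row-mass-runs letter BY NAME** (DEF-1's
`stabilityBRunRowsAtRecordR13SepCoPH_of_k17_rowsContAll`; idea-7 g13 `…_of_k17_rowMassRunsAll`).  CONDITIONAL on both displayed texts; K1⁸ NOT closed; counts unmoved.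
[cite: Balaban1989LargeFieldII, Thm 1 p.355; Balaban1987RG1, Thm 3 p.264, (5.10) p.293, §1 pp.263-264] -/
theorem stabilityBRunRowsAtRecordR13SepCoPH_of_k17_rowMassRunsText (h1 : StabilityBAtRecordR13SepCoPH)
    (h : ∀ (F : T4Family) (θ : Node00.Stage13HParams F 2), θ.Provisos₁₃SepCoPH F 2 → θ.Admissible F 2 →
      ∃ (γ L s s' : ℝ) (Λ : ℕ → ℕ → ℝ), HistLipschitz Λ γ (Node00.betaOfRecord₁₃ F 2 θ.toStage13Params) ∧ (∀ k, ∑ i : Fin (k + 1), |Λ k i| ≤ L) ∧ 0 < γ ∧ 0 < s ∧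
        ∀ K : ℕ, ∃ r : ℕ → ℝ, RGEqH K (Node00.betaOfRecord₁₃ F 2 θ.toStage13Params) r ∧ Step.InInterval γ K r ∧ Step.Discrete031 s s' K (r K) r) :
    StabilityBRunRowsAtRecordR13SepCoPH :=
  stabilityBRunRowsAtRecordR13SepCoPH_of_k17_rowsContAll h1 (rowsContAll_of_rowMassRunsText h)

end Asides

/-! ## §4 K1 «v9» LINE 2 on the row-mass road (V-rungs BY NAME; anchor-free, drift-free) -/

section Line2

variable {β : HBeta} {γ L s s' : ℝ} {Λ : ℕ → ℕ → ℝ}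

/-- **THE RUN-LETTER BUNDLE OF THE V-STUBS 2ⱽ∘3ⱽ AT ANY CEILING, ROW-MASS ROAD** (generic `β`): U3ᴷ-lite moduli with row mass `L` on `]0, γ]` (`γ > 0`) + one lower-(0.31) run per depth at slope
`s > 0` and ANY ceiling `c ≥ s′ + 2Lγ + 2L∕√s` ⟹ «∃ b r γ₀ B M, 0 < γ₀ ∧ RunConstRemainder β b r γ₀ ∧ (∀ k, b k ≤ B) ∧ B + r ≤ c ∧ PS floor −M ∧ SurvCont β γ₀» (the sibling's
`rowsBounded_of_runs_rowMass`: `b_k = β_k(γ₀̄)`, `r = Lγ₀`, `B = s′ + Lγ₀ + 2L∕√s`).  CONDITIONAL; nothing of Bałaban's β asserted.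
[cite: Balaban1987RG1, Thm 2 (0.31) p.259, (1.22) p.264, Thm 3 p.264, §1 pp.263-264, (5.10) p.293, §5 p.298] -/
theorem runLettersAtCeiling_of_rowMass_runs (hL : HistLipschitz Λ γ β) (hM : ∀ k, ∑ i : Fin (k + 1), |Λ k i| ≤ L) (hγ : 0 < γ) (hs : 0 < s)
    (hruns : ∀ K : ℕ, ∃ r : ℕ → ℝ, RGEqH K β r ∧ Step.InInterval γ K r ∧ Step.Discrete031 s s' K (r K) r) {c : ℝ} (hc : s' + 2 * L * γ + 2 * L / Real.sqrt s ≤ c) :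
    ∃ (b : ℕ → ℝ) (r γ₀ B M : ℝ), 0 < γ₀ ∧ RunConstRemainder β b r γ₀ ∧ (∀ k, b k ≤ B) ∧ B + r ≤ c ∧
      (∀ (n : ℕ) (gs : ℕ → ℝ), RGEqH n β gs → Step.InInterval γ₀ n gs → ∀ k, k ≤ n → -M ≤ ∑ j ∈ Ico k n, β j (prefixOf gs j)) ∧
      SurvCont β γ₀ := by
  obtain ⟨b, r, γ₀, B, M, hγ₀, -, hi, hB, hBr, hiv, hC⟩ := rowsBounded_of_runs_rowMass hL hM hγ hs hruns
  exact ⟨b, r, γ₀, B, M, hγ₀, hi, hB, hBr.trans hc, hiv, hC⟩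

variable {F : T4Family}

/-- **RUNG 2ⱽ‴ `RunRowsContAtSomeRecord13PWSV F` FROM RUNG-1ⱽ DATA + THE ROW-MASS LETTERS, WITH ROOM UNDER THE CEILING**: a unity admissible `(θ, h)`, a slot `v`, an `RecordSV` world with the
thirteen nodes, U3ᴷ-lite moduli-with-row-mass for `β_θ` on `]0, γ]`, one lower-(0.31) run of `β_θ` per depth at slope `s`, and `s′ + 2Lγ + 2L∕√s ≤ w.βup` ⟹ rung 2ⱽ‴ at the SAME witness.
CONDITIONAL; closes nothing. [cite: Balaban1989LargeFieldII, Thm 1 p.355 and (0.1) pp.355-356; Balaban1987RG1, Thm 2 (0.31) p.259, Thm 3 p.264, (5.10) p.293, §1 pp.263-264 (statement shapes)] -/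
theorem runRowsContAtSomeRecord13PWSV_of_rung1VAt_rowMassRuns_le (θ : Node00.Stage13HParams F 2) (h : θ.Provisos₁₃SepCoPH F 2) (v : Node00.Revision₁₃ F 2 θ h) (w : WorldP)
    (hU : θ.ZhUnity F 2 ∧ θ.SlotsNondegenerate₁₃ F 2) (hθ : θ.Admissible F 2) (hRV : RecordSV F θ h v w) (hnodes : ∀ P : B12.RunParams, Nodes (leavesP w P))
    {γ L s s' : ℝ} {Λ : ℕ → ℕ → ℝ} (hL : HistLipschitz Λ γ (Node00.betaOfRecord₁₃ F 2 θ.toStage13Params)) (hM : ∀ k, ∑ i : Fin (k + 1), |Λ k i| ≤ L) (hγ : 0 < γ) (hs : 0 < s)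
    (hruns : ∀ K : ℕ, ∃ r : ℕ → ℝ, RGEqH K (Node00.betaOfRecord₁₃ F 2 θ.toStage13Params) r ∧ Step.InInterval γ K r ∧ Step.Discrete031 s s' K (r K) r)
    (hc : s' + 2 * L * γ + 2 * L / Real.sqrt s ≤ w.βup) : RunRowsContAtSomeRecord13PWSV F :=
  ⟨θ, h, v, w, hU, hθ, hRV, hnodes, runLettersAtCeiling_of_rowMass_runs hL hM hγ hs hruns hc⟩

/-- **RUNG 2ⱽ‴ MATCH-FREE (ceiling-keyed rung 1ⱽ) on the row-mass road**: `∀ c, ∃ w, c ≤ w.βup ∧ RecordSV F θ h v w ∧ nodes` + the row-mass letters ⟹ `RunRowsContAtSomeRecord13PWSV F` (request the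
world at `s′ + 2Lγ + 2L∕√s`).  No numeric letter.  CONDITIONAL; closes nothing. [cite: Balaban1988Convergent, Thm 1 p.262; Balaban1987RG1, Thm 2 (0.31) p.259, Thm 3 p.264, (5.10) p.293 (statement shapes)] -/
theorem runRowsContAtSomeRecord13PWSV_of_ceilingKeyedRung1V_rowMassRuns (θ : Node00.Stage13HParams F 2) (h : θ.Provisos₁₃SepCoPH F 2) (v : Node00.Revision₁₃ F 2 θ h)
    (hU : θ.ZhUnity F 2 ∧ θ.SlotsNondegenerate₁₃ F 2) (hθ : θ.Admissible F 2)
    (hfam : ∀ c : ℝ, ∃ w : WorldP, c ≤ w.βup ∧ RecordSV F θ h v w ∧ ∀ P : B12.RunParams, Nodes (leavesP w P))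
    {γ L s s' : ℝ} {Λ : ℕ → ℕ → ℝ} (hL : HistLipschitz Λ γ (Node00.betaOfRecord₁₃ F 2 θ.toStage13Params)) (hM : ∀ k, ∑ i : Fin (k + 1), |Λ k i| ≤ L) (hγ : 0 < γ) (hs : 0 < s)
    (hruns : ∀ K : ℕ, ∃ r : ℕ → ℝ, RGEqH K (Node00.betaOfRecord₁₃ F 2 θ.toStage13Params) r ∧ Step.InInterval γ K r ∧ Step.Discrete031 s s' K (r K) r) :
    RunRowsContAtSomeRecord13PWSV F := by
  obtain ⟨w, hcw, hRV, hnodes⟩ := hfam (s' + 2 * L * γ + 2 * L / Real.sqrt s)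
  exact runRowsContAtSomeRecord13PWSV_of_rung1VAt_rowMassRuns_le θ h v w hU hθ hRV hnodes hL hM hγ hs hruns hcw

/-- **★ THE REGISTERED JOINT STUB TEXT 2ⱽ∘3ⱽ «∀ F, NodesAtSomeRecord13PWSV F → RunRowsContAtSomeRecord13PWSV F» ON THE ROW-MASS ROAD**, from TWO letters: `hN11V` = N11 ceiling-uniform at rung-1ⱽ
core data (p630391 §2b's shape: for every ceiling `c`, SOME window `γ' ∈ ]0, w.γ]` with `Dag.B14_main` at `{w with βup := c, γ := γ'}` on every run — ONE node), and the ∀θ ROW-MASS-RUNS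
letter (idea-7's `RowMassRunsAll`, INLINE: at every admissible tuple with provisos, U3ᴷ-lite moduli WITH ROW MASS and one lower-(0.31) run of `β_θ` per depth).  ANCHOR-FREE, DRIFT-FREE,
FADING-FREE.  The stub-1ⱽ pins are read and dropped.  CONDITIONAL on both displayed texts (none supplied here); closes NO stub by itself; nothing of Bałaban asserted.
[cite: Balaban1988Convergent, Thm 1 p.262, (2.6) p.255; Balaban1989LargeFieldII, Thm 1 p.355; Balaban1987RG1, Thm 2 (0.31) p.259, Thm 3 p.264, (2.12)-(2.14) p.268, (5.10) p.293, §5 p.298 (statement shapes)] -/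
theorem stub_runRowsCont13VText_of_n11CUV_rowMassRunsText
    (hN11V : ∀ (F : T4Family) (θ : Node00.Stage13HParams F 2) (h : θ.Provisos₁₃SepCoPH F 2) (v : Node00.Revision₁₃ F 2 θ h) (w : WorldP),
      (θ.ZhUnity F 2 ∧ θ.SlotsNondegenerate₁₃ F 2) → θ.Admissible F 2 → RecordSV F θ h v w → (∀ P : B12.RunParams, Nodes (leavesP w P)) →
      ∀ c : ℝ, ∃ γ' : ℝ, 0 < γ' ∧ γ' ≤ w.γ ∧ ∀ P : B12.RunParams, Dag.B14_main (leavesP { w with βup := c, γ := γ' } P))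
    (hRM : ∀ (F : T4Family) (θ : Node00.Stage13HParams F 2), θ.Provisos₁₃SepCoPH F 2 → θ.Admissible F 2 →
      ∃ (γ L s s' : ℝ) (Λ : ℕ → ℕ → ℝ), HistLipschitz Λ γ (Node00.betaOfRecord₁₃ F 2 θ.toStage13Params) ∧ (∀ k, ∑ i : Fin (k + 1), |Λ k i| ≤ L) ∧ 0 < γ ∧ 0 < s ∧
        ∀ K : ℕ, ∃ r : ℕ → ℝ, RGEqH K (Node00.betaOfRecord₁₃ F 2 θ.toStage13Params) r ∧ Step.InInterval γ K r ∧ Step.Discrete031 s s' K (r K) r) :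
    ∀ F : T4Family, NodesAtSomeRecord13PWSV F → RunRowsContAtSomeRecord13PWSV F := by
  intro F hN
  obtain ⟨θ, h, v, w, hU, hθ, hRV, hnodes, -, -⟩ := hN
  obtain ⟨γ, L, s, s', Λ, hL, hM, hγ, hs, hruns⟩ := hRM F θ h hθ
  exact runRowsContAtSomeRecord13PWSV_of_ceilingKeyedRung1V_rowMassRuns θ h v hU hθ
    (ceilingKeyedRung1V_of_nodes_of_b14Raise θ h v w hRV hnodes (hN11V F θ h v w hU hθ hRV hnodes)) hL hM hγ hs hruns

/-- **… HENCE THE REGISTERED `stub_runRows13PWSV` SIGNATURE `∀ F, NodesAtSomeRecord13PWSV F → RunRowsAtSomeRecord13PWSV F` LITERALLY, under the same two letters** ((C) dropped).  CONDITIONAL; the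
registered stub is NOT closed by this theorem. [cite: Balaban1987RG1, Thm 2 (0.31) p.259, Thm 3 p.264, (5.10) p.293 (statement shapes)] -/
theorem stub_runRows13PWSVText_of_n11CUV_rowMassRunsText
    (hN11V : ∀ (F : T4Family) (θ : Node00.Stage13HParams F 2) (h : θ.Provisos₁₃SepCoPH F 2) (v : Node00.Revision₁₃ F 2 θ h) (w : WorldP),
      (θ.ZhUnity F 2 ∧ θ.SlotsNondegenerate₁₃ F 2) → θ.Admissible F 2 → RecordSV F θ h v w → (∀ P : B12.RunParams, Nodes (leavesP w P)) →
      ∀ c : ℝ, ∃ γ' : ℝ, 0 < γ' ∧ γ' ≤ w.γ ∧ ∀ P : B12.RunParams, Dag.B14_main (leavesP { w with βup := c, γ := γ' } P))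
    (hRM : ∀ (F : T4Family) (θ : Node00.Stage13HParams F 2), θ.Provisos₁₃SepCoPH F 2 → θ.Admissible F 2 →
      ∃ (γ L s s' : ℝ) (Λ : ℕ → ℕ → ℝ), HistLipschitz Λ γ (Node00.betaOfRecord₁₃ F 2 θ.toStage13Params) ∧ (∀ k, ∑ i : Fin (k + 1), |Λ k i| ≤ L) ∧ 0 < γ ∧ 0 < s ∧
        ∀ K : ℕ, ∃ r : ℕ → ℝ, RGEqH K (Node00.betaOfRecord₁₃ F 2 θ.toStage13Params) r ∧ Step.InInterval γ K r ∧ Step.Discrete031 s s' K (r K) r) :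
    ∀ F : T4Family, NodesAtSomeRecord13PWSV F → RunRowsAtSomeRecord13PWSV F :=
  fun F hN => runRowsAtSomeRecord13PWSV_of_runRowsContAtSomeRecord13PWSV F (stub_runRowsCont13VText_of_n11CUV_rowMassRunsText hN11V hRM F hN)

/-- **★★ K1⁹ stmt-QuantumFields-27364 BY NAME ON THE ROW-MASS ROAD, LINE 2 — ∃-side producer, letters AT THE WITNESS**: for every family with a unity Stage-13 tuple, SOME unity admissible `(θ, h)`,
SOME slot `v`, a CEILING-KEYED family of `RecordSV` worlds of the revised datum with the thirteen nodes, U3ᴷ-lite moduli-with-row-mass for `β_θ` and one lower-(0.31) run of `β_θ` per depth ⟹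
`…Theses.BalabanUVNodes.StabilityBRunRowsAtRecordR13SepCoPHV` (through DEF-1's `K1V9Defs.stabilityBRunRowsAtRecordR13SepCoPHV_of_rung0_runRowsContV` over n13-w3's V-END road).  ANCHOR-FREE,
DRIFT-FREE.  CONDITIONAL on `hprod` (not supplied here); K1⁹ NOT closed; nothing of Bałaban asserted; no count moved.
[cite: Balaban1989LargeFieldII, Thm 1 p.355 and (0.1) pp.355-356; Balaban1988Convergent, Thm 1 p.262, Cor. 3 (2.50) p.264; Balaban1987RG1, (0.20) p.256, Thm 2 (0.31) p.259, Thm 3 p.264, (2.12)-(2.14) p.268, (5.10) p.293, §1 pp.263-264, §5 p.298] -/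
theorem stabilityBRunRowsAtRecordR13SepCoPHV_of_ceilingKeyedRung1VWithRowMassRuns
    (hprod : ∀ F : T4Family, Inhabited13 F →
      ∃ (θ : Node00.Stage13HParams F 2) (h : θ.Provisos₁₃SepCoPH F 2) (v : Node00.Revision₁₃ F 2 θ h), (θ.ZhUnity F 2 ∧ θ.SlotsNondegenerate₁₃ F 2) ∧ θ.Admissible F 2 ∧
        (∀ c : ℝ, ∃ w : WorldP, c ≤ w.βup ∧ RecordSV F θ h v w ∧ ∀ P : B12.RunParams, Nodes (leavesP w P)) ∧
        ∃ (γ L s s' : ℝ) (Λ : ℕ → ℕ → ℝ), HistLipschitz Λ γ (Node00.betaOfRecord₁₃ F 2 θ.toStage13Params) ∧ (∀ k, ∑ i : Fin (k + 1), |Λ k i| ≤ L) ∧ 0 < γ ∧ 0 < s ∧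
          ∀ K : ℕ, ∃ r : ℕ → ℝ, RGEqH K (Node00.betaOfRecord₁₃ F 2 θ.toStage13Params) r ∧ Step.InInterval γ K r ∧ Step.Discrete031 s s' K (r K) r) :
    StabilityBRunRowsAtRecordR13SepCoPHV :=
  stabilityBRunRowsAtRecordR13SepCoPHV_of_rung0_runRowsContV fun F hinh => by
    obtain ⟨θ, hP, v, hU, hθ, hfam, γ, L, s, s', Λ, hL, hM, hγ, hs, hruns⟩ := hprod F hinh
    exact runRowsContAtSomeRecord13PWSV_of_ceilingKeyedRung1V_rowMassRuns θ hP v hU hθ hfam hL hM hγ hs hruns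

/-- **★ THE REGISTERED `stub_cont13V` SIGNATURE FROM MODULI ON SOME BOX** (generalises p630391 `stub_cont13VText_of_histModuliU`, whose box is `]0, θ.γ]`): at every admissible tuple with
provisos and unity∧slots, history moduli `HistLipschitz Λ γ β_θ` on SOME box `]0, γ]`, `γ > 0` (e.g. the row-mass-runs letter's own box) ⟹ `∀ F, RunRowsAtSomeRecord13PWSV F →
RunRowsContAtSomeRecord13PWSV F`: keep the witness and its rows, cut the level to `min γ₀ γ` (`RunConstRemainder.mono`, the floor restricted), read (C) there from the moduli
(`betaContH_of_histLipschitz`, `box_mono`, DEF-1's `SurvCont.of_betaContH`).  CONDITIONAL on the letter; the registered stub is NOT closed by this theorem.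
[cite: Balaban1987RG1, §1 pp.263-264, (2.13) p.268 and Thm 3 p.264] -/
theorem stub_cont13VText_of_boxModuli
    (hMod : ∀ (F : T4Family) (θ : Node00.Stage13HParams F 2), θ.Provisos₁₃SepCoPH F 2 → (θ.ZhUnity F 2 ∧ θ.SlotsNondegenerate₁₃ F 2) → θ.Admissible F 2 →
      ∃ (γ : ℝ) (Λ : ℕ → ℕ → ℝ), 0 < γ ∧ HistLipschitz Λ γ (Node00.betaOfRecord₁₃ F 2 θ.toStage13Params)) :
    ∀ F : T4Family, RunRowsAtSomeRecord13PWSV F → RunRowsContAtSomeRecord13PWSV F := by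
  intro F hrows
  obtain ⟨θ, h, v, w, hU, hθ, hRV, hnodes, b, r, γ₀, B, M, hγ₀, hrem, hB, hmatch, hps⟩ := hrows
  obtain ⟨γ, Λ, hγ, hL⟩ := hMod F θ h hU hθ
  have hγ₁ : 0 < min γ₀ γ := lt_min hγ₀ hγ
  refine ⟨θ, h, v, w, hU, hθ, hRV, hnodes, b, r, min γ₀ γ, B, M, hγ₁, hrem.mono (min_le_left _ _), hB, hmatch, ?_,
    SurvCont.of_betaContH hγ₁ fun k => (T4BetaStationary.betaContH_of_histLipschitz hL k).mono (FlowStep.box_mono (min_le_right _ _) k)⟩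
  intro n gs hrg hI k hk
  exact hps n gs hrg (fun j hj => ⟨(hI j hj).1, (hI j hj).2.trans (min_le_left _ _)⟩) k hk

/-- **★★ K1⁹ BY NAME FROM THE REGISTERED STUB 1ⱽ TEXT + N11CU AT THE SLOT WORLD + THE ∀θ ROW-MASS-RUNS LETTER** (DEF-1's `K1V9Defs.stabilityBRunRowsAtRecordR13SepCoPHV_of_stubTextsV` = plan g86's
`k1R9_of_stubsV` over the tree names): `h₁` = the registered `stub_nodes13PWSV` signature; `h₂` = `stub_runRows13PWSV`'s text from {N11CU, the row-mass-runs letter} (§4 ★); `h₃` = `stub_cont13V`'s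
text from the letter's MODULI ALONE on their own box (`stub_cont13VText_of_boxModuli`).  THE LINE-2 LEDGER OF THE ROW-MASS ROAD: stub 2ⱽ ⟸ {N11CU at the slot world (ONE node), U3ᴷ-lite
moduli-with-row-mass, (α♭) one lower-(0.31) run per depth}; stub 3ⱽ ⟸ {moduli}; stub 1ⱽ = N13 ∕ engine lanes (untouched).  ANCHOR-FREE, DRIFT-FREE, FADING-FREE.  CONDITIONAL on three displayed
texts (none supplied here); K1⁹ NOT closed; no stub proved; nothing of Bałaban asserted; no count moved.
[cite: Balaban1988Convergent, Thm 1 p.262, (2.6) p.255, Cor. 3 (2.50) p.264; Balaban1989LargeFieldII, Thm 1 p.355 and (0.1) pp.355-356; Balaban1987RG1, (0.20) p.256, Thm 2 (0.31) p.259, Thm 3 p.264, (2.12)-(2.14) p.268, (5.10) p.293, §1 pp.263-264, §5 p.298] -/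
theorem stabilityBRunRowsAtRecordR13SepCoPHV_of_stub1VText_n11CUV_rowMassRunsText
    (h₁ : ∀ F : T4Family, Inhabited13 F → NodesAtSomeRecord13PWSV F)
    (hN11V : ∀ (F : T4Family) (θ : Node00.Stage13HParams F 2) (h : θ.Provisos₁₃SepCoPH F 2) (v : Node00.Revision₁₃ F 2 θ h) (w : WorldP),
      (θ.ZhUnity F 2 ∧ θ.SlotsNondegenerate₁₃ F 2) → θ.Admissible F 2 → RecordSV F θ h v w → (∀ P : B12.RunParams, Nodes (leavesP w P)) →
      ∀ c : ℝ, ∃ γ' : ℝ, 0 < γ' ∧ γ' ≤ w.γ ∧ ∀ P : B12.RunParams, Dag.B14_main (leavesP { w with βup := c, γ := γ' } P))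
    (hRM : ∀ (F : T4Family) (θ : Node00.Stage13HParams F 2), θ.Provisos₁₃SepCoPH F 2 → θ.Admissible F 2 →
      ∃ (γ L s s' : ℝ) (Λ : ℕ → ℕ → ℝ), HistLipschitz Λ γ (Node00.betaOfRecord₁₃ F 2 θ.toStage13Params) ∧ (∀ k, ∑ i : Fin (k + 1), |Λ k i| ≤ L) ∧ 0 < γ ∧ 0 < s ∧
        ∀ K : ℕ, ∃ r : ℕ → ℝ, RGEqH K (Node00.betaOfRecord₁₃ F 2 θ.toStage13Params) r ∧ Step.InInterval γ K r ∧ Step.Discrete031 s s' K (r K) r) :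
    StabilityBRunRowsAtRecordR13SepCoPHV :=
  stabilityBRunRowsAtRecordR13SepCoPHV_of_stubTextsV h₁ (stub_runRows13PWSVText_of_n11CUV_rowMassRunsText hN11V hRM)
    (stub_cont13VText_of_boxModuli fun F θ hP _hU hθ => by
      obtain ⟨γ, -, -, -, Λ, hL, -, hγ, -, -⟩ := hRM F θ hP hθ
      exact ⟨γ, Λ, hγ, hL⟩)

end Line2

end Summit.QuantumFields.YangMills.Theorems.BalabanUVNodesK2CornerRoadRowMassRunsKeyed

end
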